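import Summits.BirchSwinnertonDyer.Uniform.U2.TransportAExplicit
import Summits.BirchSwinnertonDyer.Uniform.U2.TwoTrivialIffOddTrace
import Literature.NumberTheory.EllipticCurves.GoodReductionTorsionReductionProofs
import Literature.NumberTheory.EllipticCurves.OrdinaryPrimesProofs
import HarnessLib

/-!
# Track U2, route A (cell `bsd-uniform`, seat u2-p1): the control binder «`E(ℚ_q)[2] = 0` at the
# primes `q ∣ d`» IS «`a_q(E)` odd» — route A stated on the `a_q`-ODD class verbatim

HONEST FRAMING (cell `bsd-uniform`, HOME run/shared/lean/pub/bsd-uniform/, verbatim in every file of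
the seat): a RELATIVE ("twist-transport") theorem, uniform in the twisting parameter `d`, CONDITIONAL
per base curve on named invariants of the base (`E(ℚ)[2] = 0`, `Ш(E/ℚ)[2] = 0`, `rank E(ℚ) ≤ 1`) and
on ONE input about the twist (`Ш(E^{(d)}/ℚ)[2^∞]` finite, or `r_an(E^{(d)}) ≤ 1`). It converts PAIRS,
never the class X5; it books nothing and moves no census number; no per-curve certificate is counted
as a uniform theorem. This file adds NO arithmetic input beyond the tree: it DISCHARGES the last
non-arithmetic binder of `TransportAExplicit.routeA_explicit` — Mazur–Rubin's `T = ∅` condition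
"`E(ℚ_q)[2] = 0` for every prime `q` ramified in `ℚ(√d)`" — from the cell's class condition
"`q ∤ 2N` and `a_q(E)` odd for every prime `q ∣ d`" (T4-PROOF §1, the set `𝒮′`; HOME/u2/INGREDIENTS.md
§7 F9), using two tree THEOREMS: `E(ℚ_q)[2] = 0 ⟺ Ẽ(𝔽_q)[2] = 0` at a good prime `q ≠ 2`
(`WeierstrassCurve.forall_nsmul_eq_zero_iff_reduction`, Silverman *AEC* VII.3.1(b), PROVED in
`GoodReductionTorsionReductionProofs`) and `Ẽ(𝔽_q)[2] = 0 ⟺ #Ẽ(𝔽_q)` odd `⟺ a_q` odd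
(`TwoTrivialIffOddTrace`). The multiplicative-unramified binder of Prop. 3.3 also becomes automatic
(`q ∣ d ⇒ q ∤ Δ_min ⇒ q` good). What remains as binders is ARITHMETIC and DECIDABLE on `(E, d)`:
`d ≡ 1 (mod 8)` square-free, `≠ 1`; every prime `q ∣ d` has `q ∤ Δ_min(E)` and `a_q(E)` odd;
`jacobiSym d ℓ = 1` at every odd additive prime `ℓ` and every odd multiplicative prime with
`ord_ℓ(Δ)` even; `d > 0` if `Δ_E > 0`. Residue unchanged (R-A1 … R-A7, HOME/RESIDUE.md).

## Contents
* `forall_two_nsmul_eq_zero_iff_odd_frobeniusTrace` — at a good prime `q ≠ 2` of a globally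
  minimal `W/ℚ`: `E(ℚ_q)[2] = 0 ⟺ a_q(E)` odd (THE DICTIONARY at the level Mazur–Rubin consume).
* `mr_unramified_and_T_empty_of_oddTrace` — the two Prop. 3.3 / Cor. 3.4 (ii) binders at the primes
  of `d` from the `a_q`-odd class condition (bookkeeping).
* `routeA_oddTrace` — route A on the `a_q`-odd class (finiteness input).
* `routeA_oddTrace_rank_zero` — rank-`0` bases: no Cassels–Tate, no finiteness input.
* `routeA_oddTrace_bsdp_iff` — hand-over form: `BSD(E^{(d)}, 2) ⟺ ord₂ #Ш_an(E^{(d)}) = 0`.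

WHY THIS IS NOT IN PRINT AS SUCH: as for `TransportA` — for `Sel₂(E) = 0` bases the conclusion is
Mazur–Rubin 2010 Prop. 4.2 / Boxer–Diao 2010 Thm 1.1 (no novelty claimed); the rank-ONE base case is
the assembled half ⟨R⟩ of T4-PROOF Thm B′. The dictionary lemma is Silverman VII.3.1(b) + `#Ẽ(𝔽_q) =
q + 1 − a_q`, folklore.

References: Mazur–Rubin, Invent. Math. 181 (2010) Prop. 3.3, Cor. 3.4 (ii), Prop. 4.2
[MazurRubin2010]; Silverman, *AEC* 2nd ed. (2009) VII.3.1(b), V.2 [SilvermanAEC2009]; Boxer–Diao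
2010 p. 1971 [BoxerDiao2010]; Kriz–Li 2019 Def. 4.1 [KrizLi2019]; HOME/u2/INGREDIENTS.md §7 F9.
-/

noncomputable section

open scoped Classical AddSubgroup

open NumberField WeierstrassCurve Literature.NumberTheory.EllipticCurves
  Literature.NumberTheory.EllipticCurves.Rank1Residual
  Summit.BirchSwinnertonDyer.Rank1Residual

namespace Summit.BirchSwinnertonDyer.Uniform.U2

/-! ## §1 The dictionary at the level Mazur–Rubin consume: `E(ℚ_q)[2] = 0 ⟺ a_q` odd -/

section Dictionary

variable (W : WeierstrassCurve ℚ) [W.IsElliptic] [W.IsGloballyMinimal]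

/-- **`E(ℚ_q)[2] = 0 ⟺ a_q(E)` odd, at a good prime `q ≠ 2`.** For a globally minimal elliptic
`W/ℚ` and a prime `q ≠ 2` with `q ∤ Δ_min(W)`: every `Q ∈ E(ℚ_q)` with `2Q = O` is `O` iff
`a_q = q + 1 − #Ẽ(𝔽_q)` is odd. Proof: `E(ℚ_q)[2] = 0 ⟺ Ẽ(𝔽_q)[2] = 0` (Silverman VII.3.1(b) with
VII.2.1, tree theorem `forall_nsmul_eq_zero_iff_reduction`, `q ∤ 2`) `⟺ #Ẽ(𝔽_q)` odd (Lagrange /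
Cauchy) `⟺ a_q` odd (`q` odd). [cite: SilvermanAEC2009, Prop. VII.3.1(b) and V.2] -/
theorem forall_two_nsmul_eq_zero_iff_odd_frobeniusTrace {q : ℕ} [Fact q.Prime] (hq2 : q ≠ 2)
    (hgood : ¬ (q : ℤ) ∣ minimalDiscriminantInt W) :
    (∀ Q : (W.baseChange ℚ_[q]).toAffine.Point, 2 • Q = 0 → Q = 0) ↔ Odd (W.frobeniusTrace q) := by
  have hq : q.Prime := Fact.out
  have hn : ¬ q ∣ 2 := fun h => hq2 ((Nat.prime_dvd_prime_iff_eq hq Nat.prime_two).mp h)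
  rw [forall_nsmul_eq_zero_iff_reduction hgood hn, odd_frobeniusTrace_iff_odd_reductionPointCount W hq hq2,
    ← W.natCard_point_padicModel_residue q]
  haveI : NeZero q := ⟨hq.ne_zero⟩
  haveI : Finite (((integralModelInt W).map (Int.castRingHom ℤ_[q])).map
      (IsLocalRing.residue ℤ_[q])).toAffine.Point := by
    apply Nat.finite_of_card_ne_zero
    rw [W.natCard_point_padicModel_residue q]
    exact (reductionPointCount_pos W q).ne'
  exact forall_two_nsmul_eq_zero_iff_odd_card

/-- **The two Mazur–Rubin binders at the primes of `d`, from the `a_q`-odd class condition**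
(bookkeeping). If `d` is odd and every prime `q ∣ d` satisfies `q ∤ Δ_min(E)` and `a_q(E)` odd, then
(Prop. 3.3) no prime of multiplicative reduction divides `d`, and (Cor. 3.4 (ii), `T = ∅`)
`E(ℚ_q)[2] = 0` for every prime `q ∣ d`. [cite: MazurRubin2010, Prop. 3.3 and Cor. 3.4 (ii)]
[cite: SilvermanAEC2009, Prop. VII.3.1(b)] -/
theorem mr_unramified_and_T_empty_of_oddTrace {d : ℤ} (hd2 : ¬ (2 : ℤ) ∣ d)
    (hS : ∀ (q : ℕ), q.Prime → (q : ℤ) ∣ d →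
      ¬ (q : ℤ) ∣ minimalDiscriminantInt W ∧ Odd (W.frobeniusTrace q)) :
    (∀ (p : ℕ) [Fact p.Prime], W.HasMultiplicativeReductionAtPrime p →
        Odd (padicValRat p W.Δ) → ¬ (p : ℤ) ∣ d) ∧
    (∀ (p : ℕ) [Fact p.Prime], (p : ℤ) ∣ d →
        ∀ Q : (W.baseChange ℚ_[p]).toAffine.Point, 2 • Q = 0 → Q = 0) := by
  refine ⟨fun p _ hm _ hpd => ?_, fun p _ hpd => ?_⟩
  · have hgood : W.HasGoodReductionAtPrime p :=
      hasGoodReductionAtPrime_of_not_dvd W p (hS p Fact.out hpd).1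
    exact WeierstrassCurve.HasMultiplicativeReduction.not_hasGoodReduction (R := ℤ_[p]) hm hgood
  · have hp2 : p ≠ 2 := by
      rintro rfl
      exact hd2 (by exact_mod_cast hpd)
    exact (forall_two_nsmul_eq_zero_iff_odd_frobeniusTrace W hp2 (hS p Fact.out hpd).1).mpr
      (hS p Fact.out hpd).2

end Dictionary

/-! ## §2 Route A on the `a_q`-odd class -/

section OddTrace

variable (W : WeierstrassCurve ℚ) [W.IsElliptic] [W.IsGloballyMinimal]

/-- **ROUTE A ON THE `a_q`-ODD CLASS.** Let `E/ℚ` be given by a globally minimal model `W` with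
`E(ℚ)[2] = 0`, `Ш(E/ℚ)[2] = 0`, `rank E(ℚ) ≤ 1`. Let `d ≡ 1 (mod 8)` be square-free, `d ≠ 1`, such
that: every prime `q ∣ d` is a prime of good reduction (`q ∤ Δ_min(E)`) with `a_q(E)` ODD; every odd
prime `ℓ` of additive reduction, and every odd prime `ℓ` of multiplicative reduction with `ord_ℓ(Δ)`
even, has `jacobiSym d ℓ = 1` (splits in `ℚ(√d)`); and `d > 0` if `Δ_E > 0`. If `Ш(E^{(d)}/ℚ)[2^∞]`
is finite then, granting Mazur–Rubin Cor. 3.4 (ii) (`hMR`, named fact, as printed) and Cassels–Tate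
(`hCT`, tree named fact): `rank E^{(d)}(ℚ) = rank E(ℚ)` and `Ш(E^{(d)}/ℚ)[2^∞] = 0`, for every model
`W'` of `E^{(d)}`. (= `routeA_explicit`, with its binders at the primes of `d` discharged by
`mr_unramified_and_T_empty_of_oddTrace`.)
[cite: MazurRubin2010, Cor. 3.4 (ii) with Prop. 3.3] [cite: SilvermanAEC2009, Prop. VII.3.1(b)] -/
theorem routeA_oddTrace (hMR : MazurRubin2010.cor34ii_rat) (hCT : exists_casselsTate_pairing (K := ℚ))
    {d : ℤ} (hd : Squarefree d) (hd1 : d ≠ 1) (hd8 : d % 8 = 1)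
    -- the `a_q`-odd class condition at the primes of `d`
    (hS : ∀ (q : ℕ), q.Prime → (q : ℤ) ∣ d →
      ¬ (q : ℤ) ∣ minimalDiscriminantInt W ∧ Odd (W.frobeniusTrace q))
    -- splitting of the odd bad primes that Prop. 3.3 requires to split
    (hadd : ∀ (p : ℕ) [Fact p.Prime], ¬ W.HasGoodReductionAtPrime p →
      ¬ W.HasMultiplicativeReductionAtPrime p → p ≠ 2 → jacobiSym d p = 1)
    (hmev : ∀ (p : ℕ) [Fact p.Prime], W.HasMultiplicativeReductionAtPrime p →
      Even (padicValRat p W.Δ) → p ≠ 2 → jacobiSym d p = 1)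
    (hreal : 0 < W.Δ → 0 < d)
    -- base data
    (hW2 : W.toAffine.Point[(2 : ℤ)] = ⊥) (hWsha : (W.sha)[(2 : ℤ)] = ⊥) (hWr : W.mordellWeilRank ≤ 1)
    -- the twist and its finiteness input
    (W' : WeierstrassCurve ℚ) [W'.IsElliptic]
    (htw : ∃ C : VariableChange ℚ, C • W' = W.quadraticTwist (d : ℚ))
    (hfin : Finite (AddCommGroup.primaryComponent W'.sha 2)) :
    W'.mordellWeilRank = W.mordellWeilRank ∧ AddCommGroup.primaryComponent W'.sha 2 = ⊥ := by
  have hd2 : ¬ (2 : ℤ) ∣ d := by omega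
  obtain ⟨hmodd, hT⟩ := mr_unramified_and_T_empty_of_oddTrace W hd2 hS
  exact routeA_explicit W hMR hCT hd hd1 hd8 hadd hmev hreal hmodd hT hW2 hWsha hWr W' htw hfin

/-- **ROUTE A ON THE `a_q`-ODD CLASS, RANK-ZERO BASES: no Cassels–Tate, no finiteness input.**
Same class binders; if `E(ℚ)[2] = 0`, `Ш(E/ℚ)[2] = 0` and `rank E(ℚ) = 0` then `rank E^{(d)}(ℚ) = 0`,
`E^{(d)}(ℚ)[2] = 0` and `Ш(E^{(d)}/ℚ)[2^∞] = 0` outright (`Sel₂(E^{(d)}) = 0`; the printed cases are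
Mazur–Rubin Prop. 4.2 and Boxer–Diao Thm 1.1). [cite: MazurRubin2010, Cor. 3.4 (ii) with Prop. 3.3, and Prop. 4.2]
[cite: SilvermanAEC2009, Prop. VII.3.1(b)] -/
theorem routeA_oddTrace_rank_zero (hMR : MazurRubin2010.cor34ii_rat)
    {d : ℤ} (hd : Squarefree d) (hd1 : d ≠ 1) (hd8 : d % 8 = 1)
    (hS : ∀ (q : ℕ), q.Prime → (q : ℤ) ∣ d →
      ¬ (q : ℤ) ∣ minimalDiscriminantInt W ∧ Odd (W.frobeniusTrace q))
    (hadd : ∀ (p : ℕ) [Fact p.Prime], ¬ W.HasGoodReductionAtPrime p →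
      ¬ W.HasMultiplicativeReductionAtPrime p → p ≠ 2 → jacobiSym d p = 1)
    (hmev : ∀ (p : ℕ) [Fact p.Prime], W.HasMultiplicativeReductionAtPrime p →
      Even (padicValRat p W.Δ) → p ≠ 2 → jacobiSym d p = 1)
    (hreal : 0 < W.Δ → 0 < d)
    (hW2 : W.toAffine.Point[(2 : ℤ)] = ⊥) (hWsha : (W.sha)[(2 : ℤ)] = ⊥) (hWr : W.mordellWeilRank = 0)
    (W' : WeierstrassCurve ℚ) [W'.IsElliptic]
    (htw : ∃ C : VariableChange ℚ, C • W' = W.quadraticTwist (d : ℚ)) :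
    W'.mordellWeilRank = 0 ∧ W'.toAffine.Point[(2 : ℤ)] = ⊥ ∧
      AddCommGroup.primaryComponent W'.sha 2 = ⊥ := by
  have hd2 : ¬ (2 : ℤ) ∣ d := by omega
  obtain ⟨hmodd, hT⟩ := mr_unramified_and_T_empty_of_oddTrace W hd2 hS
  obtain ⟨F, _, _, hF, hx, -⟩ := exists_quadraticField_of_squarefree hd hd1
  obtain ⟨h₁, h₂, h₃, h₄, h₅, h₆⟩ := mr_binders_of_arith W hd hd1 hd8 F hF hx hadd hmev hreal hmodd hT
  exact routeA_rank_zero W hMR hd hd1 F hF hx h₁ h₂ h₃ h₄ h₅ h₆ hW2 hWsha hWr W' htw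

/-- **ROUTE A ON THE `a_q`-ODD CLASS — hand-over form.** Same class binders, finiteness supplied as
`r_an(E^{(d)}) ≤ 1` (+ GZK `hGZK`): `rank E^{(d)} = rank E = r_an(E^{(d)})`, `Ш(E^{(d)})[2^∞] = 0`, and
`BSD(E^{(d)}, 2) ⟺ ord₂ #Ш_an(E^{(d)}) = 0` (Miller's `BSDp W' 2`; `shaAn W'` is `#Ш_an` for a globally
minimal `W'`). [cite: MazurRubin2010, Cor. 3.4 (ii) with Prop. 3.3] [cite: Miller2011LMS, Def. 1.1]
[cite: SilvermanAEC2009, Prop. VII.3.1(b)] -/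
theorem routeA_oddTrace_bsdp_iff (hMR : MazurRubin2010.cor34ii_rat)
    (hCT : exists_casselsTate_pairing (K := ℚ)) (hGZK : rank_eq_analyticRank_of_analyticRank_le_one)
    {d : ℤ} (hd : Squarefree d) (hd1 : d ≠ 1) (hd8 : d % 8 = 1)
    (hS : ∀ (q : ℕ), q.Prime → (q : ℤ) ∣ d →
      ¬ (q : ℤ) ∣ minimalDiscriminantInt W ∧ Odd (W.frobeniusTrace q))
    (hadd : ∀ (p : ℕ) [Fact p.Prime], ¬ W.HasGoodReductionAtPrime p →
      ¬ W.HasMultiplicativeReductionAtPrime p → p ≠ 2 → jacobiSym d p = 1)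
    (hmev : ∀ (p : ℕ) [Fact p.Prime], W.HasMultiplicativeReductionAtPrime p →
      Even (padicValRat p W.Δ) → p ≠ 2 → jacobiSym d p = 1)
    (hreal : 0 < W.Δ → 0 < d)
    (hW2 : W.toAffine.Point[(2 : ℤ)] = ⊥) (hWsha : (W.sha)[(2 : ℤ)] = ⊥) (hWr : W.mordellWeilRank ≤ 1)
    (W' : WeierstrassCurve ℚ) [W'.IsElliptic]
    (htw : ∃ C : VariableChange ℚ, C • W' = W.quadraticTwist (d : ℚ)) (hr : W'.analyticRank ≤ 1) :
    W'.mordellWeilRank = W.mordellWeilRank ∧ W'.analyticRank = W.mordellWeilRank ∧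
      AddCommGroup.primaryComponent W'.sha 2 = ⊥ ∧
      (BSDp W' 2 ↔ ∃ q : ℚ, shaAn W' = (q : ℂ) ∧ padicValRat 2 q = 0) := by
  have hd2 : ¬ (2 : ℤ) ∣ d := by omega
  obtain ⟨hmodd, hT⟩ := mr_unramified_and_T_empty_of_oddTrace W hd2 hS
  exact routeA_explicit_bsdp_iff W hMR hCT hGZK hd hd1 hd8 hadd hmev hreal hmodd hT hW2 hWsha hWr W'
    htw hr

end OddTrace

end Summit.BirchSwinnertonDyer.Uniform.U2

end
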